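import Literature.NumberTheory.EllipticCurves.CuspFormLFunction
import Literature.NumberTheory.Automorphic.AutomorphicLFunction
import HarnessLib

/-!
# A distinguishing prime `p ≪ (log N)²` for two newforms under GRH for Rankin–Selberg
# `L`-functions (Pasten, *Shimura curves and the abc conjecture*, Thm 7.3)

Topic `Literature/NumberTheory/EllipticCurves` (newform theory of the tree lives in the namespace
`Literature.NumberTheory.EllipticCurves.ModularForms`; family `abc`, LADDER-ABC A1, the *modular
method*: §7.3 "Under GRH" of H. Pasten, *Shimura curves and the abc conjecture*, J. Number Theory
**254** (2024) 214–335 = arXiv:1705.09251v4 [`PastenShimura2024`], held TeX READ at §7.3, arXiv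
p. 26; arXiv numbering as in every sibling file). This is the one input of Pasten's §7 that the tree
did not yet carry: the GRH-conditional distinguishing prime, from which Pasten's Theorem 7.4
(`log δ_{D,M} ≤ (1/12 + ε) φ(D) M log log N`) and the GRH clauses of Theorems 7.5 / 7.7 / Cor 7.8
follow (those are PROVED from this fact, at `D = 1`, in the sibling proofs file
`ModularDegreeGRHBoundProofs.lean`; compare the unconditional twin
`murty1999_lemma11_distinguishingIndex` of `MurtyDistinguishingIndex.lean`, "`n_c ≪_ε N^{1+ε}`").

## Contents

* `rankinSelbergCoeff f g n = a_n(f) a_n(g) / n` and `rankinSelbergLSeries f g s = Σ_{n ≥ 1}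
  a_n(f) a_n(g) n^{-1-s}` — the NAIVE Rankin–Selberg Dirichlet series of two cusp forms of weight
  `2` on `Γ₀(N₁)`, `Γ₀(N₂)` in the analytic normalisation `λ_f(n) = a_n(f)/√n`
  (`λ_f(n) λ_g(n) n^{-s} = a_n(f) a_n(g) n^{-1-s}`; for trivial nebentypus the coefficients are
  totally real, so no complex conjugation is needed), as a Mathlib `LSeries` of the period-`1`
  `q`-expansion coefficients `cuspCoeff` (`CuspFormLFunction.lean`). DEFINITIONS. API:
  `rankinSelbergCoeff_comm`, `rankinSelbergLSeries_comm` (symmetry) and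
  `LSeriesSummable_rankinSelbergCoeff` (absolute convergence for `re s > 2` from Hecke's trivial
  bound `a_n = O(n)`, Mathlib `CuspFormClass.qExpansion_isBigO`; the true abscissa `re s > 1`
  needs Deligne's bound and is not claimed).
* `RankinSelbergGRH f g` — **the Generalised Riemann Hypothesis for `L(s, f ⊗ g)`**, rendered by
  the tree's junk-robust right-half predicate `Literature.NumberTheory.Automorphic.IsNonvanishingOnRightHalf`
  (`AutomorphicLFunction.lean`, the form in which `AutomorphicGRH` / `GrandRiemannHypothesisGL` of
  `LFunctions/AutomorphicGRH.lean` state GRH): every holomorphic function on `{re s > 1/2} ∖ {1}`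
  agreeing with `rankinSelbergLSeries f g` on `re s > 1` is zero-free on `1/2 < re s < 1`.
  A DEFINITION (a predicate with parameters), not an assertion.
* `PastenShimura2024_thm_7_3` — NAMED FACT (CONVENTIONS §4), Pasten's **Theorem 7.3** verbatim:
  "There is an effective constant `C` such that the following holds: Let `f, g` be normalized Hecke
  newforms of weight `2` and level dividing `N`. Assume that the Generalized Riemann Hypothesis holds
  for the Rankin–Selberg `L`-functions `L(s, f ⊗ f)` and `L(s, f ⊗ g)`. Then there is a prime number
  `p_{f,g} < C · (log N)²` not dividing `N`, satisfying `a_{p_{f,g}}(f) ≠ a_{p_{f,g}}(g)`."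
  Pasten: "The following result follows from Proposition 5.22 in [IwaniecKowalski] specialized to
  classical modular forms — the necessary properties for Rankin–Selberg `L`-functions in this
  setting have been established in [WLi79]. See also [GolHof]." A published, PROVED implication
  (GRH is its HYPOTHESIS, not asserted); users take `(h : PastenShimura2024_thm_7_3)`.
* `PastenShimura2024_thm_7_3.exists_distinguishingIndex_le` — PROVED repackaging of the fact in the
  exact shape `hX` consumed by the tree's §7.2 engine
  (`Pasten2024.log_heckeCongruenceModulus_le_of_distinguishingIndex`,
  `PastenValuationProductThm75AsymptoticProofs.lean`): at a level `N` at which GRH holds for all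
  pairs (newform of level `N`, newform of level `M ∣ N`), two such newforms differing at an index
  prime to `N` differ at an index `≤ C (log N)²` prime to `N` (`C ≥ 1`).

## Why `RankinSelbergGRH` is GRH for `L(s, f ⊗ g)` (the reviewer's check)

For newforms `f ∈ S₂(Γ₀(N₁))`, `g ∈ S₂(Γ₀(N₂))` write `D(s) = Σ λ_f(n) λ_g(n) n^{-s}`
(`= rankinSelbergLSeries f g s`, absolutely convergent on `re s > 1` by `|λ(n)| ≤ d(n)`). At a prime
`p ∤ N₁N₂` the Hecke relations give `Σ_k λ_f(p^k) λ_g(p^k) X^k = (1 − X²) · L_p(f ⊗ g, X)` with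
`L_p(f ⊗ g, X)⁻¹ = ∏_{i,j} (1 − α_i β_j X)`, so on `re s > 1`

  `L(s, f ⊗ g) = D(s) · ζ^{(N₁N₂)}(2s) · ∏_{p ∣ N₁N₂} L_p(f ⊗ g, p^{-s}) / D_p(s)`,

where `ζ^{(N₁N₂)}(2s)` is holomorphic and zero-free on `re s > 1/2`, and each of the finitely many
ramified correction factors is a ratio of inverse polynomials in `p^{-s}` with roots of modulus
`≤ 1` in `p^{-s}`-aspect (`λ_f(p) ∈ {0, ±p^{-1/2}}` for `p ∣ N₁`; `|β_j| = 1` or `λ_g(p) = ±p^{-1/2}`),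
hence holomorphic and zero-free on `re s > 0`. Therefore on `{re s > 1/2}` the zeros and poles of
`L(s, f ⊗ g)` and of (the continuation of) `D` coincide; `L(s, f ⊗ g)` is entire for `f ≠ g` and has
a single simple pole at `s = 1` for `f = g` (Rankin 1939, Selberg 1940, W. Li 1979), it does not
vanish on `re s ≥ 1`, and its completed function satisfies a functional equation `s ↦ 1 − s`
(self-dual: trivial nebentypus). So "all zeros of `Λ(s, f ⊗ g)` lie on `re s = 1/2`" ⟺ "the
continuation of `D` to `{re s > 1/2} ∖ {1}` has no zero with `1/2 < re s < 1`", which is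
`IsNonvanishingOnRightHalf (rankinSelbergLSeries f g)` (the continuation exists, so the predicate is
not vacuous, and it is unique by the identity theorem — the same reading as `AutomorphicGRH`).
Nothing in this paragraph is USED in the tree: it only justifies that the hypothesis typed below is
the printed one.

## Faithfulness sheet

* `rankinSelbergCoeff`, `rankinSelbergLSeries`, `RankinSelbergGRH`: DEFINITIONS (renderings, above).
* `PastenShimura2024_thm_7_3`: FAITHFUL — "level dividing `N`" = `f ∈ S₂(Γ₀(N₁))`, `g ∈ S₂(Γ₀(N₂))`
  newforms (`IsNewform0`) with `N₁ ∣ N`, `N₂ ∣ N`; the implicit "`f ≠ g`" (without which no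
  distinguishing prime exists) is rendered as "the `q`-expansions differ at some index", which for
  newforms is equivalent (a newform is determined by its `q`-expansion); `a_p` = `cuspCoeff · p`;
  "`C` effective" is dropped (WEAKER-trivially, as in every sibling). No smallness of `N` is
  excluded in print, none here.
* `….exists_distinguishingIndex_le`: PROVED corollary (the `hX` shape; `C` enlarged to `max C 1`).

## What is NOT here

Iwaniec–Kowalski's Prop. 5.22 in its axiomatic generality (the tree's `SelbergClass` /
`StandardLFunctionData` would carry it; not needed by Pasten's application); the analytic
continuation and functional equation of `L(s, f ⊗ g)` (Rankin, Selberg, Li) — not asserted; Deligne's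
bound; Pasten's Thm 7.4 and the GRH clauses of Thms 7.5/7.7/Cor 7.8 (PROVED at `D = 1` in
`ModularDegreeGRHBoundProofs.lean`; the `D > 1` clauses need the Jacquet–Langlands class count
`r_{D,M}` on `𝕋_{D,M}`, no carrier in the tree). No discharge of the fact is attempted (IK Prop. 5.22
is an explicit-formula argument under GRH; XL over the tree).

## References

* [PastenShimura2024] H. Pasten, *Shimura curves and the abc conjecture*, J. Number Theory 254
  (2024) 214–335 = arXiv:1705.09251v4: §7.3 Theorem 7.3 (arXiv p. 26), Theorem 7.4 (p. 27).
* [IwaniecKowalski2004] H. Iwaniec, E. Kowalski, *Analytic Number Theory*, AMS Colloquium Publ. 53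
  (2004): Prop. 5.22 (and §5.7, the Grand Riemann Hypothesis).
* W.-C. W. Li, *`L`-series of Rankin type and their functional equations*, Math. Ann. 244 (1979)
  135–166 (Pasten's [WLi79]); D. Goldfeld, J. Hoffstein, *On the number of Fourier coefficients that
  determine a modular form*, Contemp. Math. 143 (1993) (Pasten's [GolHof]) — cited by Pasten, not
  used here.
-/

noncomputable section

open scoped MatrixGroups ModularForm
open CongruenceSubgroup UpperHalfPlane Filter Asymptotics

namespace Literature.NumberTheory.EllipticCurves.ModularForms

open Literature.NumberTheory.Automorphic (IsNonvanishingOnRightHalf)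

variable {N₁ N₂ : ℕ}

/-! ### The naive Rankin–Selberg series of two weight-two cusp forms -/

/-- The `n`-th coefficient `λ_f(n) λ_g(n) = a_n(f) a_n(g) / n` of the naive Rankin–Selberg series of
two cusp forms of weight `2` (analytic normalisation `λ(n) = a_n/√n`, so that the critical line of
`L(s, f ⊗ g)` is `re s = 1/2`; `a_n` = the period-`1` `q`-expansion coefficient `cuspCoeff`). For
`Γ₀`-newforms the `a_n` are totally real algebraic integers, so no conjugation is needed
(Iwaniec–Kowalski §5.1/§5.11; Pasten §7.3). [cite: PastenShimura2024, §7.3 (Rankin–Selberg L-functions L(s, f ⊗ g), arXiv p. 26)] -/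
def rankinSelbergCoeff (f : CuspForm (Gamma0 N₁) 2) (g : CuspForm (Gamma0 N₂) 2) (n : ℕ) : ℂ :=
  cuspCoeff f n * cuspCoeff g n / n

/-- The **naive Rankin–Selberg Dirichlet series** `D(s) = Σ_{n ≥ 1} λ_f(n) λ_g(n) n^{-s}
= Σ_{n ≥ 1} a_n(f) a_n(g) n^{-1-s}` of two weight-`2` cusp forms (Mathlib `LSeries`; the `n = 0`
term is dropped by `LSeries.term`). On `re s > 1` it equals `L(s, f ⊗ g)` up to the factor
`ζ^{(N₁N₂)}(2s)` and finitely many ramified Euler factors, all holomorphic and zero-free on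
`re s > 1/2` (module docstring), so its zeros in `1/2 < re s < 1` are those of `L(s, f ⊗ g)`.
Absolutely convergent for `re s > 2` unconditionally (`LSeriesSummable_rankinSelbergCoeff`), for
`re s > 1` granted Deligne's bound; elsewhere the junk value of a non-summable `tsum`.
[cite: PastenShimura2024, §7.3 (L(s, f ⊗ f), L(s, f ⊗ g), arXiv p. 26)] -/
def rankinSelbergLSeries (f : CuspForm (Gamma0 N₁) 2) (g : CuspForm (Gamma0 N₂) 2) (s : ℂ) : ℂ :=
  LSeries (rankinSelbergCoeff f g) s

/-- **GRH for the Rankin–Selberg `L`-function `L(s, f ⊗ g)`** of two weight-`2` cusp forms, in the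
tree's junk-robust right-half form (`Literature.NumberTheory.Automorphic.IsNonvanishingOnRightHalf`,
as for `AutomorphicGRH`): every function holomorphic on `{re s > 1/2} ∖ {1}` that agrees with the
naive series `rankinSelbergLSeries f g` on `re s > 1` has no zero with `1/2 < re s < 1`. For newforms
this is equivalent to "all zeros of `Λ(s, f ⊗ g)` lie on `re s = 1/2`" (continuation with at most a
simple pole at `s = 1`, functional equation `s ↦ 1 − s`, non-vanishing on `re s ≥ 1`, and the
ramified/`ζ(2s)` corrections being zero-free on `re s > 1/2` — module docstring). A predicate (a
HYPOTHESIS of Pasten's Thm 7.3), never asserted. [cite: IwaniecKowalski2004, §5.7 (Grand Riemann Hypothesis) and Prop. 5.22] -/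
def RankinSelbergGRH (f : CuspForm (Gamma0 N₁) 2) (g : CuspForm (Gamma0 N₂) 2) : Prop :=
  IsNonvanishingOnRightHalf (rankinSelbergLSeries f g)

/-- The Rankin–Selberg coefficients are symmetric in `(f, g)` (`L(s, f ⊗ g) = L(s, g ⊗ f)`).
[cite: PastenShimura2024, §7.3 (the L-functions L(s, f ⊗ g), arXiv p. 26; symmetry in f, g)] -/
theorem rankinSelbergCoeff_comm (f : CuspForm (Gamma0 N₁) 2) (g : CuspForm (Gamma0 N₂) 2) :
    rankinSelbergCoeff f g = rankinSelbergCoeff g f := by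
  funext n
  unfold rankinSelbergCoeff
  rw [mul_comm]

/-- The naive Rankin–Selberg series is symmetric: `D(s; f, g) = D(s; g, f)`.
[cite: PastenShimura2024, §7.3 (the L-functions L(s, f ⊗ g), arXiv p. 26; symmetry in f, g)] -/
theorem rankinSelbergLSeries_comm (f : CuspForm (Gamma0 N₁) 2) (g : CuspForm (Gamma0 N₂) 2) :
    rankinSelbergLSeries f g = rankinSelbergLSeries g f := by
  funext s
  unfold rankinSelbergLSeries
  rw [rankinSelbergCoeff_comm]

/-- GRH for `L(s, f ⊗ g)` is the same statement as GRH for `L(s, g ⊗ f)` (same series).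
[cite: PastenShimura2024, §7.3 (GRH for L(s, f ⊗ g), arXiv p. 26; symmetry in f, g)] -/
theorem rankinSelbergGRH_comm (f : CuspForm (Gamma0 N₁) 2) (g : CuspForm (Gamma0 N₂) 2) :
    RankinSelbergGRH f g ↔ RankinSelbergGRH g f := by
  unfold RankinSelbergGRH
  rw [rankinSelbergLSeries_comm]

/-- **Hecke's trivial bound gives `λ_f(n) λ_g(n) = O(n)`** (unnormalised `a_n = O(n^{k/2}) = O(n)` in
weight `2`, Mathlib `CuspFormClass.qExpansion_isBigO`; so `a_n(f) a_n(g)/n = O(n) = O(n^{2-1})`).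
[cite: DiamondShurman2005, Prop. 5.9.1 (Hecke's bound a_n(f) = O(n^{k/2}) for cusp forms)] -/
theorem rankinSelbergCoeff_isBigO [NeZero N₁] [NeZero N₂] (f : CuspForm (Gamma0 N₁) 2)
    (g : CuspForm (Gamma0 N₂) 2) :
    rankinSelbergCoeff f g =O[atTop] fun n ↦ (n : ℝ) ^ (2 - 1 : ℝ) := by
  have hk : (fun n : ℕ ↦ (n : ℝ) ^ (((2 : ℤ) : ℝ) / 2)) = fun n : ℕ ↦ (n : ℝ) := by
    funext n
    norm_num
  have hf : cuspCoeff f =O[atTop] fun n : ℕ ↦ (n : ℝ) := by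
    have h := CuspFormClass.qExpansion_isBigO f
    rw [strictWidthInfty_Gamma0, show (fun n ↦ (qExpansion 1 ⇑f).coeff n) = cuspCoeff f from rfl,
      hk] at h
    exact h
  have hg : cuspCoeff g =O[atTop] fun n : ℕ ↦ (n : ℝ) := by
    have h := CuspFormClass.qExpansion_isBigO g
    rw [strictWidthInfty_Gamma0, show (fun n ↦ (qExpansion 1 ⇑g).coeff n) = cuspCoeff g from rfl,
      hk] at h
    exact h
  obtain ⟨C₁, hC₁⟩ := hf.bound
  obtain ⟨C₂, hC₂⟩ := hg.bound
  refine Asymptotics.IsBigO.of_bound (max C₁ 0 * max C₂ 0) ?_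
  filter_upwards [hC₁, hC₂, Filter.eventually_ge_atTop 1] with n h1 h2 hn
  have hn0 : (0 : ℝ) < n := by exact_mod_cast hn
  rw [show (2 - 1 : ℝ) = 1 by norm_num, Real.rpow_one]
  rw [Real.norm_natCast] at h1 h2 ⊢
  have h1' : ‖cuspCoeff f n‖ ≤ max C₁ 0 * n :=
    h1.trans (mul_le_mul_of_nonneg_right (le_max_left _ _) hn0.le)
  have h2' : ‖cuspCoeff g n‖ ≤ max C₂ 0 * n :=
    h2.trans (mul_le_mul_of_nonneg_right (le_max_left _ _) hn0.le)
  unfold rankinSelbergCoeff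
  rw [norm_div, norm_mul, Complex.norm_natCast, div_le_iff₀ hn0]
  calc ‖cuspCoeff f n‖ * ‖cuspCoeff g n‖ ≤ (max C₁ 0 * n) * (max C₂ 0 * n) :=
        mul_le_mul h1' h2' (norm_nonneg _) (by positivity)
    _ = max C₁ 0 * max C₂ 0 * n * n := by ring

/-- **Absolute convergence of the naive Rankin–Selberg series for `re s > 2`** (unconditional, from
Hecke's bound; the true abscissa `re s > 1` would need Deligne's bound, not used): Mathlib
`LSeriesSummable_of_isBigO_rpow`. [cite: DiamondShurman2005, Prop. 5.9.1 (Hecke's bound; absolute convergence of Dirichlet series with O(n^c) coefficients)] -/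
theorem LSeriesSummable_rankinSelbergCoeff [NeZero N₁] [NeZero N₂] (f : CuspForm (Gamma0 N₁) 2)
    (g : CuspForm (Gamma0 N₂) 2) {s : ℂ} (hs : 2 < s.re) :
    LSeriesSummable (rankinSelbergCoeff f g) s :=
  LSeriesSummable_of_isBigO_rpow hs (rankinSelbergCoeff_isBigO f g)

/-! ### Pasten's Theorem 7.3 (named fact) -/

/-- NAMED FACT — **Pasten, J. Number Theory 254 (2024), Theorem 7.3** (arXiv:1705.09251v4 §7.3
"Under GRH", p. 26; = Iwaniec–Kowalski, *Analytic Number Theory*, Prop. 5.22 specialised to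
classical weight-`2` newforms, with W. Li 1979 supplying the analytic properties of the
Rankin–Selberg `L`-functions). Printed statement: "There is an effective constant `C` such that the
following holds: Let `f, g` be normalized Hecke newforms of weight `2` and level dividing `N`. Assume
that the Generalized Riemann Hypothesis holds for the Rankin–Selberg `L`-functions `L(s, f ⊗ f)` and
`L(s, f ⊗ g)`. Then there is a prime number `p_{f,g} < C · (log N)²` not dividing `N`, satisfying
`a_{p_{f,g}}(f) ≠ a_{p_{f,g}}(g)`." Rendering: `f ∈ S₂(Γ₀(N₁))`, `g ∈ S₂(Γ₀(N₂))` newforms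
(`IsNewform0`: new, Hecke eigenform, `a₁ = 1`) with `N₁ ∣ N`, `N₂ ∣ N`; the implicit `f ≠ g` as
"the `q`-expansions differ somewhere"; GRH as `RankinSelbergGRH` (right-half form, above);
`a_p = cuspCoeff · p`; effectivity of `C` dropped. GRH is a HYPOTHESIS of this implication — nothing
about GRH is asserted. Consumers: `….exists_distinguishingIndex_le` (the `hX` shape of the tree's
§7.2 engine) and the proofs file `ModularDegreeGRHBoundProofs.lean` (Thm 7.4 at `D = 1`, the GRH
clauses of Thm 7.5, and the `abc` translation). Users take `(h : PastenShimura2024_thm_7_3)`.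
[cite: PastenShimura2024, Theorem 7.3 (arXiv §7.3, p. 26)] [cite: IwaniecKowalski2004, Prop. 5.22] -/
def PastenShimura2024_thm_7_3 : Prop :=
  ∃ C : ℝ, ∀ (N N₁ N₂ : ℕ) [NeZero N] [NeZero N₁] [NeZero N₂], N₁ ∣ N → N₂ ∣ N →
    ∀ (f : CuspForm (Gamma0 N₁) 2) (g : CuspForm (Gamma0 N₂) 2), IsNewform0 f → IsNewform0 g →
      (∃ n : ℕ, cuspCoeff f n ≠ cuspCoeff g n) →
      RankinSelbergGRH f f → RankinSelbergGRH f g →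
        ∃ p : ℕ, p.Prime ∧ ¬ p ∣ N ∧ (p : ℝ) < C * Real.log N ^ 2 ∧ cuspCoeff f p ≠ cuspCoeff g p

/-- **The fact in the shape `hX` of the tree's §7.2 engine** (PROVED repackaging): granted
`PastenShimura2024_thm_7_3`, there is `C ≥ 1` such that at every level `N` where GRH holds for
`L(s, f ⊗ f)` and `L(s, f ⊗ g)` for all pairs (`f` a newform of level `N`, `g` a newform of level
`M ∣ N`), two such newforms that differ at an index prime to `N` differ at an index `n ≤ C (log N)²`
prime to `N` (indeed at a prime `p ∤ N`). This is the hypothesis `hX` (with `X = C (log N)²`) of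
`Pasten2024.log_heckeCongruenceModulus_le_of_distinguishingIndex` /
`Pasten2024.log_modularDegree_le_card_mul_of_distinguishingIndex`
(`PastenValuationProductThm75AsymptoticProofs.lean`), the GRH replacement for Murty's
`n_c ≪_ε N^{1+ε}` — Pasten, proof of Thm 7.4: "we replace the integer `n_c` by the prime `p_{f,g}`".
[cite: PastenShimura2024, Theorem 7.4 (proof, arXiv p. 27)] -/
theorem PastenShimura2024_thm_7_3.exists_distinguishingIndex_le (h : PastenShimura2024_thm_7_3) :
    ∃ C : ℝ, 1 ≤ C ∧ ∀ (N : ℕ) [NeZero N],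
      (∀ (M : ℕ) [NeZero M], M ∣ N → ∀ (f : CuspForm (Gamma0 N) 2) (g : CuspForm (Gamma0 M) 2),
          IsNewform0 f → IsNewform0 g → RankinSelbergGRH f f ∧ RankinSelbergGRH f g) →
      ∀ (M : ℕ) [NeZero M], M ∣ N →
        ∀ (f : CuspForm (Gamma0 N) 2) (g : CuspForm (Gamma0 M) 2), IsNewform0 f → IsNewform0 g →
          (∃ n : ℕ, n.Coprime N ∧ (qExpansion 1 ⇑f).coeff n ≠ (qExpansion 1 ⇑g).coeff n) →
            ∃ n : ℕ, n.Coprime N ∧ (n : ℝ) ≤ C * Real.log N ^ 2 ∧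
              (qExpansion 1 ⇑f).coeff n ≠ (qExpansion 1 ⇑g).coeff n := by
  obtain ⟨C, hC⟩ := h
  refine ⟨max C 1, le_max_right _ _, fun N _ hGRH M _ hMN f g hf hg hdiff => ?_⟩
  obtain ⟨n, -, hn⟩ := hdiff
  obtain ⟨hff, hfg⟩ := hGRH M hMN f g hf hg
  obtain ⟨p, hp, hpN, hpC, hne⟩ := hC N N M dvd_rfl hMN f g hf hg ⟨n, hn⟩ hff hfg
  refine ⟨p, (Nat.Prime.coprime_iff_not_dvd hp).mpr hpN, ?_, hne⟩
  have hlog : 0 ≤ Real.log (N : ℝ) ^ 2 := sq_nonneg _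
  exact hpC.le.trans (mul_le_mul_of_nonneg_right (le_max_left _ _) hlog)

end Literature.NumberTheory.EllipticCurves.ModularForms

end
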